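import Summits.MatrixMultiplication.MatrixMultiplication.Theses.HessianPlane

/-!
# Birth skeleton for the crux `RegularConstancy` (stmt-MatrixMultiplication-18179) — line "transcendental anchor"

`RegularConstancy`: the asymptotic rank `R̃(u(a,b,c))` takes one value on the regular set
`U = {P ≠ 0}` of the 21-line arrangement of the Hessian plane.

Line. Points of `ℂ³` with algebraically independent coordinates ("transcendental points") all have
the same asymptotic rank, because `Aut(ℂ)` acts transitively on them (`stub_transcendentalTransitive`,
field theory: extend `ℚ(a,b,c) ≅ ℚ(a',b',c')` through transcendence bases of `ℂ`) and tensor rank —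
hence `R̃` — is invariant under a field automorphism applied entrywise, while
`u(σa,σb,σc) = σ ∘ u(a,b,c)` (`stub_autInvariance`). The content of the crux is then exactly
`stub_regularAnchored`: every REGULAR point (in particular every regular algebraic point, e.g. the
points with extra stabiliser in G₂₆) has the asymptotic rank of SOME transcendental point — "no drop
at special regular points". Composition `RegularConstancy_of` below (kernel-checked, sorries only in
the three stubs).
-/

namespace Summit.MatrixMultiplication.MatrixMultiplication.Cruxes.RegularConstancy.TranscendentalAnchor

open Literature.Computability.AlgebraicComplexity

/-- The crux, verbatim (the route decl `HessianPlane.RegularConstancy` unfolds to this). -/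
def RegularConstancy : Prop :=
  ∀ a b c a' b' c' : ℂ, a * b * c * (a ^ 3 - b ^ 3) * (b ^ 3 - c ^ 3) * (c ^ 3 - a ^ 3) * ((a ^ 3 + b ^ 3 + c ^ 3) ^ 3 - 27 * a ^ 3 * b ^ 3 * c ^ 3) ≠ 0 → a' * b' * c' * (a' ^ 3 - b' ^ 3) * (b' ^ 3 - c' ^ 3) * (c' ^ 3 - a' ^ 3) * ((a' ^ 3 + b' ^ 3 + c' ^ 3) ^ 3 - 27 * a' ^ 3 * b' ^ 3 * c' ^ 3) ≠ 0 → Literature.Computability.AlgebraicComplexity.asymptoticRank (fun x y z : Fin 3 => if x + y + z = 0 then ![a, b, c] (y - x) else (0 : ℂ)) = Literature.Computability.AlgebraicComplexity.asymptoticRank (fun x y z : Fin 3 => if x + y + z = 0 then ![a', b', c'] (y - x) else (0 : ℂ))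

/-- STUB 1 (provable-now, size M): `R̃ ∘ u` is invariant under field automorphisms of `ℂ` applied
to the weights — a ring automorphism applied entrywise maps rank-`r` decompositions of every
Kronecker power to rank-`r` decompositions (and back with `σ⁻¹`), and `u(σa,σb,σc) = σ ∘ u(a,b,c)`
entrywise (entries are `0, a, b, c`). -/
theorem stub_autInvariance :
    ∀ σ : ℂ ≃+* ℂ, ∀ a b c : ℂ,
      asymptoticRank (fun x y z : Fin 3 => if x + y + z = 0 then ![σ a, σ b, σ c] (y - x) else (0 : ℂ)) =
        asymptoticRank (fun x y z : Fin 3 => if x + y + z = 0 then ![a, b, c] (y - x) else (0 : ℂ)) := by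
  sorry

/-- STUB 2 (known field theory, size L in Lean): `Aut(ℂ)` is transitive on triples of algebraically
independent complex numbers (extend `ℚ(a,b,c) ≅ ℚ(a',b',c')` to transcendence bases of `ℂ` over
both — equal cardinality `𝔠` — and then to the algebraic closure, `IsAlgClosed.lift`-style). -/
theorem stub_transcendentalTransitive :
    ∀ a b c a' b' c' : ℂ, AlgebraicIndependent ℚ ![a, b, c] → AlgebraicIndependent ℚ ![a', b', c'] →
      ∃ σ : ℂ ≃+* ℂ, σ a = a' ∧ σ b = b' ∧ σ c = c' := by
  sorry

/-- STUB 3 (the content, size XL): every regular point has the asymptotic rank of some transcendental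
point — no drop of `R̃` at the special (algebraic) regular points. Refutable by one universal
spectral point separating a regular algebraic point from the generic value. -/
theorem stub_regularAnchored :
    ∀ a b c : ℂ, a * b * c * (a ^ 3 - b ^ 3) * (b ^ 3 - c ^ 3) * (c ^ 3 - a ^ 3) *
        ((a ^ 3 + b ^ 3 + c ^ 3) ^ 3 - 27 * a ^ 3 * b ^ 3 * c ^ 3) ≠ 0 →
      ∃ a' b' c' : ℂ, AlgebraicIndependent ℚ ![a', b', c'] ∧
        asymptoticRank (fun x y z : Fin 3 => if x + y + z = 0 then ![a, b, c] (y - x) else (0 : ℂ)) =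
          asymptoticRank (fun x y z : Fin 3 => if x + y + z = 0 then ![a', b', c'] (y - x) else (0 : ℂ)) := by
  sorry

/-- COMPOSITION (kernel-checked): the three stubs imply the crux. Two regular points are anchored to
transcendental points `t, t'`; an automorphism carries `t` to `t'`; invariance closes the chain. -/
theorem RegularConstancy_of
    (h₁ : ∀ σ : ℂ ≃+* ℂ, ∀ a b c : ℂ,
      asymptoticRank (fun x y z : Fin 3 => if x + y + z = 0 then ![σ a, σ b, σ c] (y - x) else (0 : ℂ)) =
        asymptoticRank (fun x y z : Fin 3 => if x + y + z = 0 then ![a, b, c] (y - x) else (0 : ℂ)))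
    (h₂ : ∀ a b c a' b' c' : ℂ, AlgebraicIndependent ℚ ![a, b, c] → AlgebraicIndependent ℚ ![a', b', c'] →
      ∃ σ : ℂ ≃+* ℂ, σ a = a' ∧ σ b = b' ∧ σ c = c')
    (h₃ : ∀ a b c : ℂ, a * b * c * (a ^ 3 - b ^ 3) * (b ^ 3 - c ^ 3) * (c ^ 3 - a ^ 3) *
        ((a ^ 3 + b ^ 3 + c ^ 3) ^ 3 - 27 * a ^ 3 * b ^ 3 * c ^ 3) ≠ 0 →
      ∃ a' b' c' : ℂ, AlgebraicIndependent ℚ ![a', b', c'] ∧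
        asymptoticRank (fun x y z : Fin 3 => if x + y + z = 0 then ![a, b, c] (y - x) else (0 : ℂ)) =
          asymptoticRank (fun x y z : Fin 3 => if x + y + z = 0 then ![a', b', c'] (y - x) else (0 : ℂ))) :
    RegularConstancy := by
  intro a b c a' b' c' hr hr'
  obtain ⟨p, q, r, hpqr, hw⟩ := h₃ a b c hr
  obtain ⟨p', q', r', hpqr', hw'⟩ := h₃ a' b' c' hr'
  obtain ⟨σ, hp, hq, hrr⟩ := h₂ p q r p' q' r' hpqr hpqr'
  rw [hw, hw', ← hp, ← hq, ← hrr, h₁ σ p q r]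

/-- The skeleton closes the crux from its stubs. -/
theorem RegularConstancy_of_stubs : RegularConstancy :=
  RegularConstancy_of stub_autInvariance stub_transcendentalTransitive stub_regularAnchored

end Summit.MatrixMultiplication.MatrixMultiplication.Cruxes.RegularConstancy.TranscendentalAnchor
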